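import Summits.BirchSwinnertonDyer.BirchSwinnertonDyer.Theorems.QuadraticBranchSignedControlPlusEtaNonsurjFineRoad
import Summits.BirchSwinnertonDyer.BirchSwinnertonDyer.Theorems.QuadraticBranchSignedControlPlusEtaNonsurjPrimeLFunction
import Summits.BirchSwinnertonDyer.BirchSwinnertonDyer.Theorems.QuadraticBranchSignedControlPlusEtaNonsurjMuSaturation
import Literature.NumberTheory.EllipticCurves.IwasawaModuleFinitePadicIntProofs
import HarnessLib

/-!
# Route `QuadraticBranchSignedControl` (rung K8, cell `bsd-potss`), residual crux
# `PlusEtaMainConjectureNonsurj` (stmt-BirchSwinnertonDyer-19606): the FINE ROAD, part 2 — the `μ`-part of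
# Kobayashi's even main conjecture at `η` IS Coates–Sujatha's (A) for the ADDITIVE partner `W = V^{(p*)}`,
# granted the analytic `μ = 0`; compositions with the landed rank-`0` / CM / prime-`L` roads (seat k8eta-c2 g6)

WHAT. Part 1 (`…PlusEtaNonsurjFineRoad`) proved, on k8q-c3 g6's PINNED `η`-frame of Kobayashi's Thm.
6.2/6.3/7.3 i)/Cor. 7.2 (`EtaColemanPoitouTateData`), that every characteristic generator of
`X⁺(V/K_∞)^η` has unit content as soon as `Col⁺(z) = L_p⁺(V,η,X)` has and `X⁰(W/ℚ_∞)` is finitely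
generated over `ℤ_p`, and conversely. THIS FILE states it at class level with the named fact
`Kobayashi2003.thm62_63_73_etaColemanPoitouTate` (`h6273`) in hypothesis position and statement (A) in
the cell's currency `∀ κ cyclotomic, ∃ γ (D : W.FineSelmerDualData κ γ), Module.Finite ℤ_p D.X` —
VERBATIM the hypothesis `hA` of `Kato2004.rankZero_…_of_additive_potGood_of_irreducible_of_fineSelmerDual_fg`
and the conclusion of `DeoRaySujatha2023.thm39_…` / the two sides of `LimSujatha2018.prop32_…` (PROVED) —
and composes BY NAME with the landed roads:
* §3 `fine_moduleFinite_of_conjA` (the `∃ γ D` currency reaches ANY datum: Pontryagin algebra PROVED in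
  the tree, `IwasawaModuleFinitePadicInt.*`, `FineSelmerDualData.module_finite_of_finite_pTorsion`);
  **`eta_hasUnitContent_of_conjA_of_analyticMu`**: (A)(W,p) ∧ `μ(L_p⁺(V,η,X)) = 0` ⟹ `p ∤ Char`-generators
  of every datum of `Sel⁺(V/K_∞)^η` on every `η`-frame (NO image hypothesis, NO anchor); the converse
  `conjA_of_etaMuZero` (frame-relative: the `μ`-stub of 19606 is AT LEAST (A) on the partners, given
  Thm. 2.2η); `etaUpperIntegral_of_conjA_of_analyticMu`: the INTEGRAL Kato-side inclusion
  `EtaUpperIntegralAt V p` verbatim (+ Thm. 4.1η rational clause, Gauss), i.e. g2's `μ`-saturation with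
  its `μ`-binder DISCHARGED by (A) + `μ_an`.
* §4 at a pair: rank-`0` non-CM (+ L₀; ctrl g4 p464359), rank-`0` CM (bsd.S28; p467934), prime-`L`
  rank `1` (g4 p508939) — there the analytic `μ = 0` is AUTOMATIC from `(L_p⁺(V,η,X)) = (X)`, so
  **(C1⁺_η)(V) ⟸ (A)(W,p) ALONE** (modulo `h22`, `h41`, `h6273`).
CONSEQUENCES FOR THE CENSUS (recorded, not formalised): since (A) is a mod-`p` congruence invariant
(Lim–Sujatha, proved) ANY congruent curve with (A) transfers the `μ`-stub — not only unit rows / CM unit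
classes; and (A) has an ANCHOR-FREE per-row certificate in ANY rank (Deo–Ray–Sujatha 2023 Thm. 3.7–3.9:
`H²(ℚ_S/ℚ, W[p]) = 0`, i.e. `Ш¹_S(ℚ, W[p]) = 0` and `W(ℚ_v)[p] = 0` at `v ∈ S`), available on the
rank-`1` members of g5's `σ = −1` classes where no unit anchor can exist.

HONEST FRAMING (cell `bsd-potss`; FULL-BSD rank ≤ 1 programme, HUMAN RULING D-0036/D-0074): BOOKKEEPING
THEOREMS ONLY — no definition, no named Literature fact minted, no Summits-side `def … : Prop`, no
`sorry`, axioms standard. CONDITIONAL on the displayed named facts (`h6273`: Coleman maps, Kato's Euler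
system, Poitou–Tate along the tower — NOT in Mathlib; `h22`, `h41`, `hPT`, `hmod`, `hGZK`, `hKO`, `hS28`
as in g2/g4) and on the DISPLAYED per-row inputs (A)(W,p) (OPEN in general; a theorem for no class of
additive curves in print) and `μ(L_p⁺(V,η,X)) = 0` (analytic; class-wide open). No stub of 19606 is
proved by name; the crux stays OPEN; nothing is booked; `BSD(W,p)` is claimed for no pair. What is proved
is an IDENTIFICATION of residuals: modulo print and the analytic `μ`, 19606's `μ`-content = (A) on the
additive partners. `--supports stmt-BirchSwinnertonDyer-19606`.

References: [Kobayashi2003] Thm. 7.3 i) (7.21), Cor. 7.2, proof of Thm. 7.4 (p. 13), §4 Even main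
conjecture + Thm. 4.1 first display (p. 8), Thm. 2.2 (p. 5); [CoatesSujatha2005] §3 statement (A);
[LimSujatha2018] §3 Prop. 3.2; [DeoRaySujatha2023] Thm. 3.7–3.9; [Kato2004Asterisque] Thm. 12.4, §17.13;
[GreenbergVatsal2000] p. 2 (2); [Washington1997] §13.2; [GreenbergLNM1716] §1 p. 60, §4 Lemma 4.2;
[PollackRubin2004] p. 448; [BurungaleFlach2024] Thm. 1.1; [Miller2011LMS] Def. 1.1.
-/

set_option autoImplicit false
set_option linter.dupNamespace false

noncomputable section

open scoped Classical

open CongruenceSubgroup Field Function NumberField IsDedekindDomain WeierstrassCurve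
open Literature.NumberTheory.EllipticCurves
open Literature.NumberTheory.EllipticCurves.ModularForms
open Literature.NumberTheory.EllipticCurves.Rank1Residual
open Literature.NumberTheory.EllipticCurves.Rank1Residual.Typed
open Literature.NumberTheory.GaloisRepresentations
open Literature.NumberTheory.GaloisCohomology
open Literature.NumberTheory.EllipticCurves.IwasawaAlgebra
open Literature.NumberTheory.EllipticCurves.IwasawaDual ZpExtension
open Literature.NumberTheory.EllipticCurves.GreenbergVatsal2000
open Summit.BirchSwinnertonDyer.Rank1Residual.X11b.Levels
open Summit.BirchSwinnertonDyer.Rank1Residual.X11b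
open Summit.BirchSwinnertonDyer.Rank1Residual.Additive
open Summit.BirchSwinnertonDyer.Rank1Residual.Additive.SignedTwist
open scoped ContRepresentation
open Summit.BirchSwinnertonDyer.Rank1Residual.AdditivePotMult

namespace Summit.BirchSwinnertonDyer.BirchSwinnertonDyer.Theorems

namespace EtaFineRoad

/-! ## §3 Class level: (A)(W,p) ∧ `μ(L_p⁺(V,η,X)) = 0` ⟺ `μ(X⁺(V/K_∞)^η) = 0`, modulo Kobayashi 6.2/6.3/7.3 at `η` -/

section ClassLevel

variable (W : WeierstrassCurve ℚ) [W.IsElliptic] (p : ℕ) [hp : Fact p.Prime]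

omit [W.IsElliptic] in
/-- **From the cell's `∃ γ D` currency of (A) to ANY dual fine Selmer datum** (Pontryagin algebra, PROVED
in the tree): if some datum of `Sel₀(ℚ_∞, W[p^∞])` is finitely generated over `ℤ_p` then
`Sel₀(ℚ_∞, W[p^∞])[p]` is finite (`IwasawaModuleFinitePadicInt.finite_pTorsion_of_fineSelmerDualData_moduleFinite`),
hence every datum on a topological generator is finitely generated over `Λ` with `X₀/(p)X₀` finite, hence
finitely generated over `ℤ_p` (Lim–Sujatha §3 lemma; Greenberg LNM 1716 §1 p. 60).
[cite: LimSujatha2018, §3 (the lemma before Prop. 3.2)] [cite: GreenbergLNM1716, §1 p. 60] -/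
theorem fine_moduleFinite_of_conjA {κ : ZpExtension ℚ p}
    (hA : ∃ (γ : absoluteGaloisGroup ℚ) (D : W.FineSelmerDualData κ γ),
      Module.Finite ℤ_[p] (RestrictScalars ℤ_[p] (IwasawaAlgebra p) D.X))
    {γ : absoluteGaloisGroup ℚ} (hγ : κ.IsTopGenerator γ) (FB : W.FineSelmerDualData κ γ) :
    Module.Finite ℤ_[p] (RestrictScalars ℤ_[p] (IwasawaAlgebra p) FB.X) := by
  obtain ⟨γ', D, hD⟩ := hA
  have hfin := IwasawaModuleFinitePadicInt.finite_pTorsion_of_fineSelmerDualData_moduleFinite W κ D hD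
  haveI : Module.Finite (IwasawaAlgebra p) FB.X := FB.module_finite_of_finite_pTorsion hγ hfin
  exact IwasawaModuleFinitePadicInt.moduleFinite_padicInt_of_finite_quotient_augIdealP p FB.X
    (FB.finite_quotient_augIdealP_of_finite_pTorsion hfin)

/-- **THE FINE ROAD (class level, ⟸): (A)(W,p) ∧ `μ(L_p⁺(V,η,X)) = 0 ⟹ μ(X⁺(V/K_∞)^η) = 0` on every
`η`-frame.** `W` globally minimal, `V` a globally minimal model of `W^{(p*)}` (`C • W^{(p*)} = V`);
DISPLAYED: `hA` — statement (A) of Coates–Sujatha for `W` at `p` over the cyclotomic `ℤ_p`-extension, in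
the cell's currency (verbatim the hypothesis of `Kato2004.rankZero_…_of_fineSelmerDual_fg` and the
conclusion of `DeoRaySujatha2023.thm39_…`); `hμan` — every plus `p`-adic `L`-function of `V` at `η` has
unit content (analytic `μ = 0`; choice-free); NAMED fact `h6273` (Kobayashi Thm. 6.2/6.3/7.3 i)/Cor. 7.2 at
`η` on pinned objects). CONCLUSION: for every `η`-frame (`K₀ = ℚ(μ_p)`, `ηq` the quadratic character of
`Δ`, `p ≠ 2`, `V` good at `p` with `a_p = 0`, newform `f`, period ratio `ϖ`, cyclotomic `κ`, topological
generator `γ ∈ Gal(ℚ̄/K₀)` matching the cyclotomic variable) and every datum `D` of `Sel⁺(V/K_∞)^η`: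
`Char(D.X) = (g) ⟹ p ∤ g`. Proof: pin `𝐇¹_Γ(T_pW)` (`Kato2004.nonempty_iwasawaH1Data_holds`) and
`X⁰(W/ℚ_∞)` (`nonempty_fineSelmerDualData`), take the frame datum of `h6273`, §2. NO image hypothesis,
NO anchor, NO `BSD_p`, NO Poitou–Tate over `ℚ`. CONDITIONAL; nothing booked.
[cite: Kobayashi2003, Thm. 7.3 i) (7.21), Cor. 7.2, Thm. 6.2–6.3 (pp. 11–13)] [cite: CoatesSujatha2005, §3 statement (A)]
[cite: GreenbergVatsal2000, p. 2 (2)] -/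
theorem eta_hasUnitContent_of_conjA_of_analyticMu
    (h6273 : Kobayashi2003.thm62_63_73_etaColemanPoitouTate)
    (V : WeierstrassCurve ℚ) [V.IsElliptic] [V.IsGloballyMinimal] (C : VariableChange ℚ)
    (hCV : C • W.quadraticTwist ((-1) ^ (p / 2) * p) = V)
    (hA : ∀ (κ : ZpExtension ℚ p), κ.IsCyclotomic →
      ∃ (γ : absoluteGaloisGroup ℚ) (D : W.FineSelmerDualData κ γ),
        Module.Finite ℤ_[p] (RestrictScalars ℤ_[p] (IwasawaAlgebra p) D.X))
    (hμan : ∀ {N : ℕ} [NeZero N] {f : CuspForm (Gamma0 N) 2}, IsNewformOf V f →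
      ∀ (ϖ : ℚ), (if Even (p / 2) then (ϖ : ℝ) * V.realPeriodRat = plusPeriod f
          else (ϖ : ℝ) * V.imaginaryPeriodRat = minusPeriod f) →
      ∀ (Lη : IwasawaAlgebra p), IsQuadraticBranchPlusLFunction f p ϖ Lη → HasUnitContent Lη) :
    ∀ (K₀ : Type) [Field K₀] [NumberField K₀] [IsCyclotomicExtension {p} ℚ K₀]
        [(galRange (K := ℚ) K₀).Normal] (ηq : absoluteGaloisGroup ℚ →* ℤˣ),
        (∀ σ ∈ galRange (K := ℚ) K₀, ηq σ = 1) → ηq ≠ 1 →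
      ∀ {N : ℕ} [NeZero N] {f : CuspForm (Gamma0 N) 2},
        p ≠ 2 → V.HasGoodReductionAtPrime p → V.frobeniusTrace p = 0 → IsNewformOf V f →
      ∀ (ϖ : ℚ), (if Even (p / 2) then (ϖ : ℝ) * V.realPeriodRat = plusPeriod f
          else (ϖ : ℝ) * V.imaginaryPeriodRat = minusPeriod f) →
      ∀ (κ : ZpExtension ℚ p) (γ : absoluteGaloisGroup ℚ),
        κ.IsCyclotomic → κ.IsTopGenerator γ → γ ∈ galRange (K := ℚ) K₀ → IsCyclotomicVariable p γ →
      ∀ (D : EtaSignedSelmerDualData V κ K₀ ℚ_[p] ηq γ 1) (g : IwasawaAlgebra p),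
        D.charIdeal = Ideal.span {g} → HasUnitContent g := by
  intro K₀ _ _ _ _ ηq hηK hη1 N _ f hp2 hgood hap hf ϖ hϖ κ γ hκ hγ hγK hγc D g hg
  haveI : ContinuousSMul ℤ_[p] (W.tateModule p) := TateModule.continuousSMul_padicInt
  obtain ⟨I⟩ := Kato2004.nonempty_iwasawaH1Data_holds W p κ γ hκ hγ
  obtain ⟨FB⟩ := W.nonempty_fineSelmerDualData κ hγ
  obtain ⟨E⟩ := h6273 p K₀ ηq hηK hη1 V hp2 hgood hap hf ϖ hϖ κ γ hκ hγ hγK hγc W C hCV I FB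
  have hLu : HasUnitContent (E.colPlus E.z) := hμan hf ϖ hϖ _ E.isPlus_colPlus_z
  have hFB := fine_moduleFinite_of_conjA W p (hA κ hκ) hγ FB
  exact eta_hasUnitContent_of_fine E hγ hLu hFB D.toLiterature hg

/-- **THE FINE ROAD (class level, ⟹, frame-relative): `μ(X⁺(V/K_∞)^η) = 0 ⟹` (A)(W,p).** Granted
Thm. 2.2η (`h22`: finite generation and torsion of the `η`-data) and `h6273`: on every `η`-frame, if every
characteristic generator of every datum of `Sel⁺(V/K_∞)^η` has unit content, then EVERY dual fine Selmer
datum of `W` over that cyclotomic `κ` (on that generator `γ`) is finitely generated over `ℤ_p`, and the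
cell's `∃ γ D` form of (A)(W,p) at `κ` holds. So any proof of `stub_etaMC_r0_mu` / `stub_etaMC_r1_mu`
proves Coates–Sujatha's (A) for the additive partners on its rows. CONDITIONAL; nothing booked.
[cite: Kobayashi2003, Thm. 7.3 i) (7.21) (p. 13), Thm. 2.2 (p. 5)] [cite: CoatesSujatha2005, §3 statement (A)] -/
theorem conjA_of_etaMuZero
    (h22 : Kobayashi2003.thm22_etaSignedSelmerDual_finite_torsion)
    (h6273 : Kobayashi2003.thm62_63_73_etaColemanPoitouTate)
    (V : WeierstrassCurve ℚ) [V.IsElliptic] [V.IsGloballyMinimal] (C : VariableChange ℚ)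
    (hCV : C • W.quadraticTwist ((-1) ^ (p / 2) * p) = V)
    (K₀ : Type) [Field K₀] [NumberField K₀] [IsCyclotomicExtension {p} ℚ K₀]
    [(galRange (K := ℚ) K₀).Normal] (ηq : absoluteGaloisGroup ℚ →* ℤˣ)
    (hηK : ∀ σ ∈ galRange (K := ℚ) K₀, ηq σ = 1) (hη1 : ηq ≠ 1)
    {N : ℕ} [NeZero N] {f : CuspForm (Gamma0 N) 2}
    (hp2 : p ≠ 2) (hgood : V.HasGoodReductionAtPrime p) (hap : V.frobeniusTrace p = 0)
    (hf : IsNewformOf V f) (ϖ : ℚ)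
    (hϖ : if Even (p / 2) then (ϖ : ℝ) * V.realPeriodRat = plusPeriod f
      else (ϖ : ℝ) * V.imaginaryPeriodRat = minusPeriod f)
    {κ : ZpExtension ℚ p} {γ : absoluteGaloisGroup ℚ} (hκ : κ.IsCyclotomic) (hγ : κ.IsTopGenerator γ)
    (hγK : γ ∈ galRange (K := ℚ) K₀) (hγc : IsCyclotomicVariable p γ)
    (hμ : ∀ (D : EtaSignedSelmerDualData V κ K₀ ℚ_[p] ηq γ 1) (g : IwasawaAlgebra p),
      D.charIdeal = Ideal.span {g} → HasUnitContent g) :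
    (∀ FB : W.FineSelmerDualData κ γ, Module.Finite ℤ_[p] (RestrictScalars ℤ_[p] (IwasawaAlgebra p) FB.X)) ∧
      ∃ (γ' : absoluteGaloisGroup ℚ) (D : W.FineSelmerDualData κ γ'),
        Module.Finite ℤ_[p] (RestrictScalars ℤ_[p] (IwasawaAlgebra p) D.X) := by
  haveI : ContinuousSMul ℤ_[p] (W.tateModule p) := TateModule.continuousSMul_padicInt
  obtain ⟨I⟩ := Kato2004.nonempty_iwasawaH1Data_holds W p κ γ hκ hγ
  -- one `η`-datum (non-vacuity) with its generator
  obtain ⟨D⟩ := nonempty_etaSignedSelmerDualData_cyclotomic V κ K₀ ℚ_[p] ηq (1 : ℤˣ) hγ hγK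
  obtain ⟨hfin, htor⟩ := EtaSignedSelmerDualData.finite_isTorsion_of_thm22 h22 hηK hp2 hgood hap hκ hγ hγK D
  haveI : D.charIdeal.IsPrincipal := charIdeal_isPrincipal_holds p D.X
  obtain ⟨g, hg⟩ := Submodule.IsPrincipal.principal D.charIdeal
  have hg' : D.charIdeal = Ideal.span {g} := hg
  have hgu : HasUnitContent g := hμ D g hg'
  have key : ∀ FB : W.FineSelmerDualData κ γ,
      Module.Finite ℤ_[p] (RestrictScalars ℤ_[p] (IwasawaAlgebra p) FB.X) := by
    intro FB
    obtain ⟨E⟩ := h6273 p K₀ ηq hηK hη1 V hp2 hgood hap hf ϖ hϖ κ γ hκ hγ hγK hγc W C hCV I FB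
    haveI : Module.Finite (IwasawaAlgebra p) D.toLiterature.X := hfin
    exact fine_moduleFinite_of_eta_hasUnitContent E D.toLiterature htor hg' hgu
  obtain ⟨FB⟩ := W.nonempty_fineSelmerDualData κ hγ
  exact ⟨key, γ, FB, key FB⟩

/-- **The INTEGRAL Kato-side inclusion at `η` from (A)(W,p) and the analytic `μ`, image-free** — the
conclusion `EtaUpperIntegralAt V p` of the stubs `stub_etaMC_nonCM_upper` / the consequence of
`stub_etaMC_r0_mu` at `(V,p)`, VERBATIM: Thm. 4.1 at `η`, rational clause (`h41` with `h22`: `pⁿ·Lη ∈ Char`)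
+ `p ∤ g` from the fine road + Gauss (`dvd_of_dvd_C_pow_mul_of_hasUnitContent`), exactly as g2's
`EtaMuSaturation.etaUpperIntegral_of_hasUnitContent` with its `μ`-binder DISCHARGED by (A)(W,p) and `μ_an`.
CONDITIONAL on `h22`, `h41`, `h6273` and the two displayed inputs; nothing booked.
[cite: Kobayashi2003, Thm. 4.1 first display (p. 8), Thm. 2.2 (p. 5), Thm. 7.3 i) (7.21) (p. 13)]
[cite: CoatesSujatha2005, §3 statement (A)] [cite: GreenbergVatsal2000, p. 2 (2)] -/
theorem etaUpperIntegral_of_conjA_of_analyticMu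
    (h22 : Kobayashi2003.thm22_etaSignedSelmerDual_finite_torsion)
    (h41 : Kobayashi2003.thm41_plusEtaCharIdeal_dvd)
    (h6273 : Kobayashi2003.thm62_63_73_etaColemanPoitouTate)
    (V : WeierstrassCurve ℚ) [V.IsElliptic] [V.IsGloballyMinimal] (C : VariableChange ℚ)
    (hCV : C • W.quadraticTwist ((-1) ^ (p / 2) * p) = V)
    (hA : ∀ (κ : ZpExtension ℚ p), κ.IsCyclotomic →
      ∃ (γ : absoluteGaloisGroup ℚ) (D : W.FineSelmerDualData κ γ),
        Module.Finite ℤ_[p] (RestrictScalars ℤ_[p] (IwasawaAlgebra p) D.X))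
    (hμan : ∀ {N : ℕ} [NeZero N] {f : CuspForm (Gamma0 N) 2}, IsNewformOf V f →
      ∀ (ϖ : ℚ), (if Even (p / 2) then (ϖ : ℝ) * V.realPeriodRat = plusPeriod f
          else (ϖ : ℝ) * V.imaginaryPeriodRat = minusPeriod f) →
      ∀ (Lη : IwasawaAlgebra p), IsQuadraticBranchPlusLFunction f p ϖ Lη → HasUnitContent Lη) :
    ∀ (K₀ : Type) [Field K₀] [NumberField K₀] [IsCyclotomicExtension {p} ℚ K₀]
        [(galRange (K := ℚ) K₀).Normal] (ηq : absoluteGaloisGroup ℚ →* ℤˣ),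
        (∀ σ ∈ galRange (K := ℚ) K₀, ηq σ = 1) → ηq ≠ 1 →
      ∀ {N : ℕ} [NeZero N] {f : CuspForm (Gamma0 N) 2},
        p ≠ 2 → V.HasGoodReductionAtPrime p → V.frobeniusTrace p = 0 → IsNewformOf V f →
      ∀ (ϖ : ℚ), (if Even (p / 2) then (ϖ : ℝ) * V.realPeriodRat = plusPeriod f
          else (ϖ : ℝ) * V.imaginaryPeriodRat = minusPeriod f) →
      ∀ (Lη : IwasawaAlgebra p), IsQuadraticBranchPlusLFunction f p ϖ Lη →
      ∀ (κ : ZpExtension ℚ p) (γ : absoluteGaloisGroup ℚ),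
        κ.IsCyclotomic → κ.IsTopGenerator γ → γ ∈ galRange (K := ℚ) K₀ → IsCyclotomicVariable p γ →
      ∀ (D : EtaSignedSelmerDualData V κ K₀ ℚ_[p] ηq γ 1), Ideal.span {Lη} ≤ D.charIdeal := by
  intro K₀ _ _ _ _ ηq hηK hη1 N _ f hp2 hgood hap hf ϖ hϖ Lη hL κ γ hκ hγ hγK hγc D
  -- Thm. 4.1 at `η`, rational clause: `pⁿ·Lη ∈ Char`
  obtain ⟨⟨n, hn⟩, -⟩ := EtaSignedSelmerDualData.thm41_plus_of_facts h22 h41 hηK hη1 hp2 hgood hap hf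
    ϖ hϖ Lη hL hκ hγ hγK hγc D
  -- a generator of `Char(X⁺(V/K_∞)^η)`, of unit content by the fine road
  haveI : D.charIdeal.IsPrincipal := charIdeal_isPrincipal_holds p D.X
  obtain ⟨g, hg⟩ := Submodule.IsPrincipal.principal D.charIdeal
  have hg' : D.charIdeal = Ideal.span {g} := hg
  have hu : HasUnitContent g := eta_hasUnitContent_of_conjA_of_analyticMu W p h6273 V C hCV hA hμan K₀ ηq
    hηK hη1 hp2 hgood hap hf ϖ hϖ κ γ hκ hγ hγK hγc D g hg'
  -- `g ∣ pⁿ·Lη`, hence `g ∣ Lη` (Gauss)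
  rw [hg', Ideal.mem_span_singleton] at hn
  have hC : ((p : IwasawaAlgebra p) ^ n : IwasawaAlgebra p) = PowerSeries.C ((p : ℤ_[p]) ^ n) := by
    rw [map_pow, map_natCast]
  rw [hC] at hn
  rw [hg']
  exact Ideal.span_singleton_le_span_singleton.mpr (dvd_of_dvd_C_pow_mul_of_hasUnitContent hu n hn)

end ClassLevel

/-! ## §4 Compositions with the landed roads: 19606 at a pair from (A)(W,p) (+ `μ_an`; + L₀ on non-CM r0) -/

section Rows

variable (W : WeierstrassCurve ℚ) [W.IsElliptic] [W.IsGloballyMinimal] (p : ℕ) [hp : Fact p.Prime]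

/-- **Rank-`0` non-CM shape: (C1⁺_η)(V) ⟸ (A)(W,p) + `μ(L_p⁺(V,η,X)) = 0` + L₀(W,p).** `W` globally minimal,
`p ≥ 5`, `V` a globally minimal model of `W^{(p*)}` good at `p` with `a_p(V) = 0`, `L(W,1) ≠ 0`,
`Typed.MissingLowerBoundAt W p`; named facts `hPT`, `hmod`, `hGZK`, `h22`, `h41`, `hKO`, `h6273`. §3's
integral upper inclusion fed to ctrl g4's
`ConverseControl.quadraticBranchPlusEtaMainConjectureAt_of_etaUpperIntegral_of_missingLowerBoundAt`
(p464359). Compared with g2's `…_of_hasUnitContent_of_missingLowerBoundAt`: the OPEN `μ`-binder is replaced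
by (A)(W,p) + the analytic `μ`. CONDITIONAL; nothing booked.
[cite: Kobayashi2003, §4 Even main conjecture and Thm. 4.1 (p. 8), Thm. 7.3 i) (p. 13)]
[cite: CoatesSujatha2005, §3 statement (A)] [cite: Miller2011LMS, Def. 1.1] -/
theorem quadraticBranchPlusEtaMainConjectureAt_of_conjA_of_analyticMu_of_missingLowerBoundAt
    (hPT : poitouTate_selmerStructure_duality_real ℚ) (hmod : hasEntireLFunction_rat)
    (hGZK : rank_eq_analyticRank_of_analyticRank_le_one)
    (h22 : Kobayashi2003.thm22_etaSignedSelmerDual_finite_torsion)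
    (h41 : Kobayashi2003.thm41_plusEtaCharIdeal_dvd)
    (hKO : KitajimaOtsuki2018.mainThm13_etaSignedSelmerDual_noFiniteSubmodule)
    (h6273 : Kobayashi2003.thm62_63_73_etaColemanPoitouTate)
    (V : WeierstrassCurve ℚ) [V.IsElliptic] [V.IsGloballyMinimal] (C : VariableChange ℚ)
    (hp5 : 5 ≤ p) (hCV : C • W.quadraticTwist ((-1) ^ (p / 2) * p) = V)
    (hgood : V.HasGoodReductionAtPrime p) (hap : V.frobeniusTrace p = 0)
    (hA : ∀ (κ : ZpExtension ℚ p), κ.IsCyclotomic →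
      ∃ (γ : absoluteGaloisGroup ℚ) (D : W.FineSelmerDualData κ γ),
        Module.Finite ℤ_[p] (RestrictScalars ℤ_[p] (IwasawaAlgebra p) D.X))
    (hμan : ∀ {N : ℕ} [NeZero N] {f : CuspForm (Gamma0 N) 2}, IsNewformOf V f →
      ∀ (ϖ : ℚ), (if Even (p / 2) then (ϖ : ℝ) * V.realPeriodRat = plusPeriod f
          else (ϖ : ℝ) * V.imaginaryPeriodRat = minusPeriod f) →
      ∀ (Lη : IwasawaAlgebra p), IsQuadraticBranchPlusLFunction f p ϖ Lη → HasUnitContent Lη)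
    (hLW : W.entireLFunction 1 ≠ 0) (hlow : MissingLowerBoundAt W p) :
    QuadraticBranchPlusEtaMainConjectureAt V p :=
  ConverseControl.quadraticBranchPlusEtaMainConjectureAt_of_etaUpperIntegral_of_missingLowerBoundAt W p
    hPT hmod hGZK h22 hKO V C hp5 hCV hgood hap
    (etaUpperIntegral_of_conjA_of_analyticMu W p h22 h41 h6273 V C hCV hA hμan) hLW hlow

/-- **Rank-`0` CM shape: (C1⁺_η)(V) ⟸ (A)(W,p) + `μ(L_p⁺(V,η,X)) = 0` ALONE** (the lower half is bsd.S28,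
Burungale–Flach, through ctrl g4's `…_of_etaUpperIntegral_of_hasCM_rankZero`, p467934): `V` CM, `p ≥ 5`,
good with `a_p(V) = 0`, `C • W^{(p*)} = V`, `L(W,1) ≠ 0`. So on the CM rank-`0` rows of 19606 the
`μ`-question of the CM main conjecture at `η` (Pollack–Rubin's remark p. 448; Burungale–Tian 2026 Rem. 2.7)
is (A) for the CM additive partner `W`. CONDITIONAL; nothing booked.
[cite: Kobayashi2003, §4 Even main conjecture and Thm. 4.1 (p. 8)] [cite: BurungaleFlach2024, Thm 1.1 and Cor. 2]
[cite: PollackRubin2004, Theorem and remark p. 448] [cite: CoatesSujatha2005, §3 statement (A)] -/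
theorem quadraticBranchPlusEtaMainConjectureAt_of_conjA_of_analyticMu_of_hasCM_rankZero
    (hPT : poitouTate_selmerStructure_duality_real ℚ) (hmod : hasEntireLFunction_rat)
    (hGZK : rank_eq_analyticRank_of_analyticRank_le_one)
    (h22 : Kobayashi2003.thm22_etaSignedSelmerDual_finite_torsion)
    (h41 : Kobayashi2003.thm41_plusEtaCharIdeal_dvd)
    (hKO : KitajimaOtsuki2018.mainThm13_etaSignedSelmerDual_noFiniteSubmodule)
    (hS28 : bsdTriple_of_hasCM_of_L_one_ne_zero)
    (h6273 : Kobayashi2003.thm62_63_73_etaColemanPoitouTate)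
    (V : WeierstrassCurve ℚ) [V.IsElliptic] [V.IsGloballyMinimal] (C : VariableChange ℚ)
    (hp5 : 5 ≤ p) (hCV : C • W.quadraticTwist ((-1) ^ (p / 2) * p) = V)
    (hgood : V.HasGoodReductionAtPrime p) (hap : V.frobeniusTrace p = 0) (hCM : V.HasCM)
    (hA : ∀ (κ : ZpExtension ℚ p), κ.IsCyclotomic →
      ∃ (γ : absoluteGaloisGroup ℚ) (D : W.FineSelmerDualData κ γ),
        Module.Finite ℤ_[p] (RestrictScalars ℤ_[p] (IwasawaAlgebra p) D.X))
    (hμan : ∀ {N : ℕ} [NeZero N] {f : CuspForm (Gamma0 N) 2}, IsNewformOf V f →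
      ∀ (ϖ : ℚ), (if Even (p / 2) then (ϖ : ℝ) * V.realPeriodRat = plusPeriod f
          else (ϖ : ℝ) * V.imaginaryPeriodRat = minusPeriod f) →
      ∀ (Lη : IwasawaAlgebra p), IsQuadraticBranchPlusLFunction f p ϖ Lη → HasUnitContent Lη)
    (hLW : W.entireLFunction 1 ≠ 0) :
    QuadraticBranchPlusEtaMainConjectureAt V p :=
  ConverseControl.quadraticBranchPlusEtaMainConjectureAt_of_etaUpperIntegral_of_hasCM_rankZero W p hPT hmod
    hGZK h22 hKO hS28 V C hp5 hCV hgood hap hCM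
    (etaUpperIntegral_of_conjA_of_analyticMu W p h22 h41 h6273 V C hCV hA hμan) hLW

omit [W.IsGloballyMinimal] in
/-- **Prime-`L` rank-`1` shape: (C1⁺_η)(V) ⟸ (A)(W,p) ALONE** (granted `h22`, `h41`, `h6273`). `W` globally
minimal, `p ≥ 5`, `V` a globally minimal model of `W^{(p*)}` good at `p` with `a_p(V) = 0`, `Sel_{p^∞}(W/ℚ)`
infinite, `(L_p⁺(V,η,X)) = (X)` (displayed analytic input, as in g4's road). Here the analytic `μ = 0` is
AUTOMATIC (`(Lη) = (X)`, `EtaPrimeRoad.hasUnitContent_of_span_eq_span_X`), so the fine road turns g4's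
`quadraticBranchPlusEtaMainConjectureAt_of_span_eq_span_X_of_hasUnitContent` (p508939) into: the even
main conjecture at `η` on a prime-`L` rank-`1` row IS statement (A) for the additive partner. Proof = g4's
three lines with the `μ`-binder discharged by §3 at the frame's own `(f, ϖ, γ)`. CONDITIONAL; nothing booked.
[cite: Kobayashi2003, §4 Even main conjecture and Thm. 4.1 first display (p. 8), Thm. 7.3 i) (p. 13)]
[cite: CoatesSujatha2005, §3 statement (A)] [cite: GreenbergLNM1716, §4 Lemma 4.2 (p. 102)] -/
theorem quadraticBranchPlusEtaMainConjectureAt_of_span_eq_span_X_of_conjA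
    (h22 : Kobayashi2003.thm22_etaSignedSelmerDual_finite_torsion)
    (h41 : Kobayashi2003.thm41_plusEtaCharIdeal_dvd)
    (h6273 : Kobayashi2003.thm62_63_73_etaColemanPoitouTate)
    (V : WeierstrassCurve ℚ) [V.IsElliptic] [V.IsGloballyMinimal] (C : VariableChange ℚ)
    (hp5 : 5 ≤ p) (hCV : C • W.quadraticTwist ((-1) ^ (p / 2) * p) = V)
    (hgood : V.HasGoodReductionAtPrime p) (hap : V.frobeniusTrace p = 0)
    (hinf : ¬ Finite ↥(W.selmerGroupPInfty p))
    (hX : ∀ {N : ℕ} [NeZero N] {f : CuspForm (Gamma0 N) 2}, IsNewformOf V f →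
      ∀ (ϖ : ℚ), (if Even (p / 2) then (ϖ : ℝ) * V.realPeriodRat = plusPeriod f
          else (ϖ : ℝ) * V.imaginaryPeriodRat = minusPeriod f) →
      ∀ (Lη : IwasawaAlgebra p), IsQuadraticBranchPlusLFunction f p ϖ Lη →
        Ideal.span {Lη} = Ideal.span {(PowerSeries.X : IwasawaAlgebra p)})
    (hA : ∀ (κ : ZpExtension ℚ p), κ.IsCyclotomic →
      ∃ (γ : absoluteGaloisGroup ℚ) (D : W.FineSelmerDualData κ γ),
        Module.Finite ℤ_[p] (RestrictScalars ℤ_[p] (IwasawaAlgebra p) D.X)) :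
    QuadraticBranchPlusEtaMainConjectureAt V p := by
  -- the analytic `μ` is free on a prime-`L` row
  have hμan : ∀ {N : ℕ} [NeZero N] {f : CuspForm (Gamma0 N) 2}, IsNewformOf V f →
      ∀ (ϖ : ℚ), (if Even (p / 2) then (ϖ : ℝ) * V.realPeriodRat = plusPeriod f
          else (ϖ : ℝ) * V.imaginaryPeriodRat = minusPeriod f) →
      ∀ (Lη : IwasawaAlgebra p), IsQuadraticBranchPlusLFunction f p ϖ Lη → HasUnitContent Lη :=
    fun hf ϖ hϖ Lη hL ↦ EtaPrimeRoad.hasUnitContent_of_span_eq_span_X (hX hf ϖ hϖ Lη hL)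
  intro K₀ _ _ _ _ ηq hηK hη1 N _ f hp2 hgood' hap' hf ϖ hϖ Lη hL κ γ hκ hγ hγK hγc D
  obtain ⟨hfin, htor⟩ :=
    EtaSignedSelmerDualData.finite_isTorsion_of_thm22 h22 hηK hp2 hgood' hap' hκ hγ hγK D
  refine ⟨hfin, htor, ?_⟩
  obtain ⟨⟨n, hn⟩, -⟩ := EtaSignedSelmerDualData.thm41_plus_of_facts h22 h41 hηK hη1 hp2 hgood' hap' hf
    ϖ hϖ Lη hL hκ hγ hγK hγc D
  have hC : ((p : IwasawaAlgebra p) ^ n : IwasawaAlgebra p) = PowerSeries.C ((p : ℤ_[p]) ^ n) := by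
    rw [map_pow, map_natCast]
  rw [hC] at hn
  haveI := hfin
  exact (EtaPrimeRoad.ideal_eq_span_iff_forall_hasUnitContent_of_span_eq_span_X
    (charIdeal_isPrincipal_holds p D.X) (hX hf ϖ hϖ Lη hL) hn (fun g hg ↦
      EtaPrimeRoad.eta_constantCoeff_charGenerator_eq_zero_of_not_finite_selmer W p V C hp5 hCV hgood hap
        hinf K₀ ηq hηK hη1 hκ hγ hγK D htor hg)).mpr (fun g hg ↦
      eta_hasUnitContent_of_conjA_of_analyticMu W p h6273 V C hCV hA hμan K₀ ηq hηK hη1 hp2 hgood' hap'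
        hf ϖ hϖ κ γ hκ hγ hγK hγc D g hg)

end Rows

end EtaFineRoad

end Summit.BirchSwinnertonDyer.BirchSwinnertonDyer.Theorems

end
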